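import Literature.NumberTheory.LFunctions.Zhang2022.Section3Lemma36Input
import Literature.NumberTheory.LFunctions.Zhang2022.Section5Lemma57
import HarnessLib

/-!
# The multiplicative majorant `|ν(n)|² ≤ (ν ∗ ν)(n)` and the smoothing step for `W_{ν∗ν}`

Topic `Literature/NumberTheory/LFunctions`. Everything here is PROVED (no definitions, no named facts).

Let `χ` be a quadratic Dirichlet character mod `D` (`χ² = 1`), `ν(n) = Σ_{d∣n} χ(d)` (the tree's
`divisorSumChar χ`, real and `≥ 0`), and `b = ν ∗ ν` the Dirichlet convolution (Mathlib's
`LSeries.convolution`, `ν ⍟ ν`; `Σ b(n) n^{-w} = ζ(w)² L(w,χ)²`). We prove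

* `norm_sq_divisorSumChar_le_conv_re` — **the majorant** `|ν(n)|² ≤ b(n)`: both sides are
  multiplicative, and at prime powers `ν(p^k)² ≤ Σ_{i ≤ k} ν(p^i) ν(p^{k-i})` (for `χ(p) = 1`:
  `(k+1)² ≤ Σ_{i≤k}(i+1)(k+1−i)` as each term is `≥ k+1`; for `χ(p) ∈ {0,−1}`: `ν(p^i) ∈ {0,1}` and
  the `i = 0` term already gives `ν(p^k)`);
* `exists_norm_conv_le` — `‖b(n)‖ ≤ C n` (divisor bound), so `W_b(Y) = Σ b(n) n^{-1} e^{-n/Y}`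
  (the tree's `DivisorSumCharSq.W`) is an absolutely convergent real series;
* `sum_Ioc_le_conv` — **the smoothing step with the majorant**: for `0 < A`, `4A ≤ B`, `A ≤ M+1`,
  `N ≤ B`, `Σ_{M < n ≤ N} |ν(n)|²/n ≤ 6 · Re (W_b(B) − W_b(A))` (`e^{-n/B} − e^{-n/A} ≥ 1/6` on
  `A ≤ n ≤ B`, the tree's `Zhang2022.Lemma31.one_sixth_le_exp_sub_exp`).

This is stub T1 of SKELETON I6c-typed (line `majorant-critical-line`, cell landau-siegel/ls-inputs)
for the typed Conrey–Iwaniec Corollary 6.3: the upper bound (6.49) is proved for the majorant `b`,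
whose generating function `ζ²L²` carries no factor `(ζ(2w) ∏_{p∣q}(1+p^{-w}))^{-1}`.

## References
* [ConreyIwaniec2002] B. Conrey, H. Iwaniec, Acta Arith. 103 (2002) 259–312, §6 (6.43), (6.47)–(6.49).
-/

noncomputable section

open Complex Finset ArithmeticFunction
open scoped LSeries.notation

namespace Literature.NumberTheory.LFunctions.DivisorSumCharSq

open Literature.NumberTheory.LFunctions.Zhang2022 (nuOf nuOf_apply_prime_pow)
open Literature.NumberTheory.LFunctions.Zhang2022.Lemma36Input (reChar_mul_all nuOf_reChar_eq
  nuOf_reChar_sq_eq)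
open Literature.NumberTheory.LFunctions.Zhang2022.Lemma31 (divisorSumChar_im_eq_zero W_ofReal
  summable_mul_exp_div one_sixth_le_exp_sub_exp)
open Literature.NumberTheory.LFunctions.Zhang2022.Lemma57 (divisorSumChar_re_nonneg)
open Literature.NumberTheory.LFunctions.DirichletAbel (reChar reChar_one reChar_trichotomy
  isMultiplicative_reChar)

variable {D : ℕ} (χ : DirichletCharacter ℂ D)

/-! ### §1. Multiplicative functions are compared at prime powers -/

omit χ in
/-- A nonnegative multiplicative `f` is dominated by a multiplicative `g` as soon as it is at every
prime power. [folklore] -/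
private theorem IsMultiplicative.le_of_prime_pow {f g : ArithmeticFunction ℝ} (hf : f.IsMultiplicative)
    (hg : g.IsMultiplicative) (h0 : ∀ n, 0 ≤ f n)
    (h : ∀ p k : ℕ, p.Prime → f (p ^ k) ≤ g (p ^ k)) (n : ℕ) : f n ≤ g n := by
  rcases eq_or_ne n 0 with rfl | hn
  · simp
  rw [hf.multiplicative_factorization _ hn, hg.multiplicative_factorization _ hn, Finsupp.prod,
    Finsupp.prod]
  refine Finset.prod_le_prod (fun p _ => h0 _) fun p hp => ?_
  rw [Nat.support_factorization] at hp
  exact h p _ (Nat.prime_of_mem_primeFactors hp)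

omit χ in
/-- `(f * f)(p^k) = Σ_{i ≤ k} f(p^i) f(p^{k-i})`. [folklore] -/
private theorem mul_self_apply_prime_pow (f : ArithmeticFunction ℝ) {p : ℕ} (hp : p.Prime) (k : ℕ) :
    (f * f) (p ^ k) = ∑ i ∈ range (k + 1), f (p ^ i) * f (p ^ (k - i)) := by
  rw [mul_apply, Nat.sum_divisorsAntidiagonal fun a b => f a * f b, Nat.divisors_prime_pow hp,
    Finset.sum_map]
  refine sum_congr rfl fun i hi => ?_
  rw [mem_range, Nat.lt_succ_iff] at hi
  simp only [Function.Embedding.coeFn_mk]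
  rw [Nat.pow_div hi hp.pos]

/-! ### §2. The majorant at prime powers -/

/-- `ν(p^k) = k + 1` if `χ(p) = 1`. [folklore] -/
private theorem nuOf_prime_pow_of_eq_one (hχ : χ ^ 2 = 1) {p : ℕ} (hp : p.Prime) (h1 : reChar χ p = 1)
    (k : ℕ) : nuOf (reChar χ) (p ^ k) = k + 1 := by
  rw [nuOf_apply_prime_pow _ (reChar_mul_all χ hχ) (reChar_one χ) hp, h1]
  simp

/-- `ν(p^k) ∈ {0, 1}` if `χ(p) ∈ {0, −1}`. [folklore] -/
private theorem nuOf_prime_pow_mem (hχ : χ ^ 2 = 1) {p : ℕ} (hp : p.Prime) (h1 : reChar χ p ≠ 1)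
    (k : ℕ) : nuOf (reChar χ) (p ^ k) = 0 ∨ nuOf (reChar χ) (p ^ k) = 1 := by
  rw [nuOf_apply_prime_pow _ (reChar_mul_all χ hχ) (reChar_one χ) hp]
  rcases reChar_trichotomy χ hχ p with h0 | h | hm1
  · rw [h0, zero_geom_sum]; simp
  · exact absurd h h1
  · rw [hm1, neg_one_geom_sum]
    split_ifs <;> simp

/-- `0 ≤ ν(n)` (as the real arithmetic function `nuOf (reChar χ)`). [folklore] -/
private theorem nuOf_reChar_nonneg (hχ : χ ^ 2 = 1) (n : ℕ) : 0 ≤ nuOf (reChar χ) n := by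
  rw [nuOf_reChar_eq]; exact divisorSumChar_re_nonneg χ hχ n

/-- `nuOf (reChar χ)` is multiplicative (quadratic `χ`). [folklore] -/
private theorem isMultiplicative_nuOf_reChar (hχ : χ ^ 2 = 1) :
    (nuOf (reChar χ)).IsMultiplicative :=
  isMultiplicative_zeta.natCast.mul (isMultiplicative_reChar χ hχ)

/-- **The majorant at prime powers**: `ν(p^k)² ≤ (ν ∗ ν)(p^k)`. [cite: ConreyIwaniec2002, §6 (6.43)] -/
theorem nuOf_sq_le_mul_prime_pow (hχ : χ ^ 2 = 1) {p : ℕ} (hp : p.Prime) (k : ℕ) :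
    nuOf (reChar χ) (p ^ k) ^ 2 ≤ (nuOf (reChar χ) * nuOf (reChar χ)) (p ^ k) := by
  rw [mul_self_apply_prime_pow _ hp]
  by_cases h1 : reChar χ p = 1
  · -- `(k+1)² ≤ Σ_{i≤k} (i+1)(k-i+1)`, each term being `≥ k+1`
    simp_rw [nuOf_prime_pow_of_eq_one χ hχ hp h1]
    have hterm : ∀ i ∈ range (k + 1), ((k : ℝ) + 1) ≤ ((i : ℕ) + 1 : ℝ) * (((k - i : ℕ) : ℝ) + 1) := by
      intro i hi
      rw [mem_range, Nat.lt_succ_iff] at hi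
      have e : ((k - i : ℕ) : ℝ) = (k : ℝ) - i := by push_cast [Nat.cast_sub hi]; ring
      rw [e]
      have hi' : (i : ℝ) ≤ k := by exact_mod_cast hi
      have hi0 : (0 : ℝ) ≤ i := Nat.cast_nonneg i
      nlinarith
    have h := Finset.card_nsmul_le_sum (range (k + 1)) _ _ hterm
    rw [card_range, nsmul_eq_mul] at h
    calc ((k : ℝ) + 1) ^ 2 = ((k + 1 : ℕ) : ℝ) * ((k : ℝ) + 1) := by push_cast; ring
      _ ≤ _ := h
  · -- `ν(p^i) ∈ {0,1}`: the `i = 0` term gives `ν(1) ν(p^k) = ν(p^k) ≥ ν(p^k)²`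
    have hsq : nuOf (reChar χ) (p ^ k) ^ 2 = nuOf (reChar χ) (p ^ 0) * nuOf (reChar χ) (p ^ (k - 0)) := by
      rw [pow_zero, Nat.sub_zero, (isMultiplicative_nuOf_reChar χ hχ).map_one, one_mul]
      rcases nuOf_prime_pow_mem χ hχ hp h1 k with h | h <;> rw [h] <;> norm_num
    rw [hsq]
    exact Finset.single_le_sum (f := fun i => nuOf (reChar χ) (p ^ i) * nuOf (reChar χ) (p ^ (k - i)))
      (fun i _ => mul_nonneg (nuOf_reChar_nonneg χ hχ _) (nuOf_reChar_nonneg χ hχ _))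
      (mem_range.2 (Nat.succ_pos k))

/-- **The majorant** for the real arithmetic functions: `ν(n)² ≤ (ν ∗ ν)(n)` for all `n`.
[cite: ConreyIwaniec2002, §6 (6.43)] -/
theorem nuOf_sq_le_mul (hχ : χ ^ 2 = 1) (n : ℕ) :
    nuOf (reChar χ) n ^ 2 ≤ (nuOf (reChar χ) * nuOf (reChar χ)) n := by
  have h := IsMultiplicative.le_of_prime_pow ((isMultiplicative_nuOf_reChar χ hχ).pmul
    (isMultiplicative_nuOf_reChar χ hχ)) ((isMultiplicative_nuOf_reChar χ hχ).mul
    (isMultiplicative_nuOf_reChar χ hχ)) (fun m => by rw [pmul_apply]; exact mul_self_nonneg _)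
    (fun p k hp => by rw [pmul_apply, ← sq]; exact nuOf_sq_le_mul_prime_pow χ hχ hp k) n
  rwa [pmul_apply, ← sq] at h

/-! ### §3. The convolution `b = ν ⍟ ν` as a complex sequence -/

/-- `(ν ⍟ ν)(n) = Σ_{ac = n} ν(a) ν(c)` (the coefficients of `ζ²L²`, the `φ`-free part of `R_K`).
[cite: ConreyIwaniec2002, §6 (6.43)] -/
theorem conv_apply (n : ℕ) :
    (divisorSumChar χ ⍟ divisorSumChar χ) n =
      ∑ x ∈ n.divisorsAntidiagonal, divisorSumChar χ x.1 * divisorSumChar χ x.2 := by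
  rw [LSeries.convolution_def]

/-- `Re (ν ⍟ ν)(n) = (ν_ℝ * ν_ℝ)(n)` with `ν_ℝ = nuOf (reChar χ)` (for `χ² = 1`, `ν` is real).
[cite: ConreyIwaniec2002, §6 (6.43)] -/
theorem conv_re_eq (hχ : χ ^ 2 = 1) (n : ℕ) :
    ((divisorSumChar χ ⍟ divisorSumChar χ) n).re = (nuOf (reChar χ) * nuOf (reChar χ)) n := by
  rw [conv_apply, Complex.re_sum, mul_apply]
  refine sum_congr rfl fun x _ => ?_
  rw [Complex.mul_re, divisorSumChar_im_eq_zero χ hχ, divisorSumChar_im_eq_zero χ hχ, mul_zero,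
    sub_zero, nuOf_reChar_eq, nuOf_reChar_eq]

/-- `Im (ν ⍟ ν)(n) = 0` for `χ² = 1`. [cite: ConreyIwaniec2002, §6 (6.43)] -/
theorem conv_im_eq_zero (hχ : χ ^ 2 = 1) (n : ℕ) :
    ((divisorSumChar χ ⍟ divisorSumChar χ) n).im = 0 := by
  rw [conv_apply, Complex.im_sum]
  refine sum_eq_zero fun x _ => ?_
  rw [Complex.mul_im, divisorSumChar_im_eq_zero χ hχ, divisorSumChar_im_eq_zero χ hχ]
  ring

/-- `(ν ⍟ ν)(n)` is the real number `Re (ν ⍟ ν)(n)`. [cite: ConreyIwaniec2002, §6 (6.43)] -/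
theorem conv_eq_ofReal_re (hχ : χ ^ 2 = 1) (n : ℕ) :
    (divisorSumChar χ ⍟ divisorSumChar χ) n = ((((divisorSumChar χ ⍟ divisorSumChar χ) n).re : ℝ) : ℂ) :=
  Complex.ext (by simp) (by simp [conv_im_eq_zero χ hχ n])

/-- `0 ≤ Re (ν ⍟ ν)(n)`. [cite: ConreyIwaniec2002, §6 (6.43)] -/
theorem conv_re_nonneg (hχ : χ ^ 2 = 1) (n : ℕ) :
    0 ≤ ((divisorSumChar χ ⍟ divisorSumChar χ) n).re := by
  rw [conv_re_eq χ hχ, mul_apply]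
  exact sum_nonneg fun x _ => mul_nonneg (nuOf_reChar_nonneg χ hχ _) (nuOf_reChar_nonneg χ hχ _)

/-- **THE MAJORANT**: `|ν(n)|² ≤ Re (ν ⍟ ν)(n)` for every `n` (quadratic `χ`).
[cite: ConreyIwaniec2002, §6 (6.43)] -/
theorem norm_sq_divisorSumChar_le_conv_re (hχ : χ ^ 2 = 1) (n : ℕ) :
    ‖divisorSumChar χ n‖ ^ 2 ≤ ((divisorSumChar χ ⍟ divisorSumChar χ) n).re := by
  rw [← nuOf_reChar_sq_eq χ hχ, conv_re_eq χ hχ]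
  exact nuOf_sq_le_mul χ hχ n

omit χ in
/-- A divisor-type bound: `‖(ν ⍟ ν)(n)‖ ≤ C n` for an absolute `C` (any Dirichlet character), so the
Dirichlet series `Σ (ν⍟ν)(n) n^{-w}` of (6.43) converges absolutely for `re w > 2`.
[cite: ConreyIwaniec2002, §6 (6.43)] -/
theorem exists_norm_conv_le (χ : DirichletCharacter ℂ D) :
    ∃ C : ℝ, 0 < C ∧ ∀ n : ℕ, ‖(divisorSumChar χ ⍟ divisorSumChar χ) n‖ ≤ C * n := by
  obtain ⟨C₀, hC₀, h⟩ := Sieve.exists_card_divisors_le_mul_rpow (by norm_num : (0 : ℝ) < 1 / 4)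
  refine ⟨C₀ ^ 3, by positivity, fun n => ?_⟩
  rcases eq_or_ne n 0 with rfl | hn
  · simp [LSeries.convolution_map_zero]
  have hn1 : (1 : ℝ) ≤ n := by exact_mod_cast Nat.one_le_iff_ne_zero.mpr hn
  rw [conv_apply]
  have hterm : ∀ x ∈ n.divisorsAntidiagonal,
      ‖divisorSumChar χ x.1 * divisorSumChar χ x.2‖ ≤ C₀ ^ 2 * (n : ℝ) ^ (1 / 4 : ℝ) := by
    intro x hx
    have hx' := Nat.mem_divisorsAntidiagonal.mp hx
    have ha0 : x.1 ≠ 0 := by rintro h0; apply hn; rw [← hx'.1, h0, zero_mul]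
    have hb0 : x.2 ≠ 0 := by rintro h0; apply hn; rw [← hx'.1, h0, mul_zero]
    rw [norm_mul]
    have ha := (norm_divisorSumChar_le χ x.1).trans (h x.1 ha0)
    have hb := (norm_divisorSumChar_le χ x.2).trans (h x.2 hb0)
    calc ‖divisorSumChar χ x.1‖ * ‖divisorSumChar χ x.2‖
        ≤ (C₀ * (x.1 : ℝ) ^ (1 / 4 : ℝ)) * (C₀ * (x.2 : ℝ) ^ (1 / 4 : ℝ)) :=
          mul_le_mul ha hb (norm_nonneg _) (by positivity)
      _ = C₀ ^ 2 * (((x.1 : ℝ) * x.2) ^ (1 / 4 : ℝ)) := by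
          rw [Real.mul_rpow (Nat.cast_nonneg _) (Nat.cast_nonneg _)]; ring
      _ = C₀ ^ 2 * (n : ℝ) ^ (1 / 4 : ℝ) := by
          rw [← Nat.cast_mul, hx'.1]
  have hcard : (n.divisorsAntidiagonal.card : ℝ) ≤ C₀ * (n : ℝ) ^ (1 / 4 : ℝ) := by
    rw [← Nat.map_div_right_divisors, Finset.card_map]; exact h n hn
  have hn4 : (n : ℝ) ^ (1 / 4 : ℝ) * (n : ℝ) ^ (1 / 4 : ℝ) ≤ n := by
    rw [← Real.rpow_add (by positivity)]
    calc (n : ℝ) ^ ((1 / 4 : ℝ) + 1 / 4) ≤ (n : ℝ) ^ (1 : ℝ) :=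
          Real.rpow_le_rpow_of_exponent_le hn1 (by norm_num)
      _ = n := Real.rpow_one _
  calc ‖∑ x ∈ n.divisorsAntidiagonal, divisorSumChar χ x.1 * divisorSumChar χ x.2‖
      ≤ ∑ x ∈ n.divisorsAntidiagonal, ‖divisorSumChar χ x.1 * divisorSumChar χ x.2‖ := norm_sum_le _ _
    _ ≤ ∑ x ∈ n.divisorsAntidiagonal, C₀ ^ 2 * (n : ℝ) ^ (1 / 4 : ℝ) := sum_le_sum hterm
    _ = n.divisorsAntidiagonal.card * (C₀ ^ 2 * (n : ℝ) ^ (1 / 4 : ℝ)) := by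
        rw [sum_const, nsmul_eq_mul]
    _ ≤ (C₀ * (n : ℝ) ^ (1 / 4 : ℝ)) * (C₀ ^ 2 * (n : ℝ) ^ (1 / 4 : ℝ)) := by gcongr
    _ = C₀ ^ 3 * ((n : ℝ) ^ (1 / 4 : ℝ) * (n : ℝ) ^ (1 / 4 : ℝ)) := by ring
    _ ≤ C₀ ^ 3 * n := by gcongr

/-! ### §4. The smoothing step with the majorant -/

/-- `W_{ν⍟ν}(Y)` is the real series `Σ Re(ν⍟ν)(n) e^{-n/Y}/n` (for `χ² = 1`; the sum `G` of (6.47) with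
`g(n) = e^{-n/Y}` for the majorant). [cite: ConreyIwaniec2002, §6 (6.47)] -/
theorem W_conv_eq (hχ : χ ^ 2 = 1) (Y : ℝ) :
    W (divisorSumChar χ ⍟ divisorSumChar χ) Y =
      ((∑' n : ℕ, ((divisorSumChar χ ⍟ divisorSumChar χ) n).re * Real.exp (-(n / Y)) / n : ℝ) : ℂ) := by
  have : (divisorSumChar χ ⍟ divisorSumChar χ) =
      fun n => ((((divisorSumChar χ ⍟ divisorSumChar χ) n).re : ℝ) : ℂ) :=
    funext (conv_eq_ofReal_re χ hχ)
  conv_lhs => rw [this]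
  rw [W_ofReal]

/-- Summability of `Σ Re(ν⍟ν)(n) e^{-n/Y}/n` for `Y > 0` ((6.47) converges).
[cite: ConreyIwaniec2002, §6 (6.47)] -/
theorem summable_conv_re {Y : ℝ} (hY : 0 < Y) :
    Summable fun n : ℕ => ((divisorSumChar χ ⍟ divisorSumChar χ) n).re * Real.exp (-(n / Y)) / n := by
  obtain ⟨C, -, hC⟩ := exists_norm_conv_le χ
  refine summable_mul_exp_div (C := C) (fun n => ?_) hY
  exact (Complex.abs_re_le_norm _).trans (hC n)

/-- The smoothing weight dominates the indicator, closed form: for `0 < A`, `4A ≤ B`, `A ≤ n ≤ B`,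
`e^{-n/B} − e^{-n/A} ≥ 1/6`. [folklore] -/
private theorem one_sixth_le_exp_sub_exp_of_le {A B n : ℝ} (hA : 0 < A) (hAB : 4 * A ≤ B) (hAn : A ≤ n)
    (hnB : n ≤ B) : 1 / 6 ≤ Real.exp (-(n / B)) - Real.exp (-(n / A)) := by
  rcases hAn.lt_or_eq with hlt | heq
  · exact one_sixth_le_exp_sub_exp hA hAB hlt hnB
  · -- `n = A`: `e^{-A/B} − e^{-1} ≥ e^{-1/4} − e^{-1} ≥ 1/6`
    subst heq
    have hB : 0 < B := by linarith
    have h1 : Real.exp (-(1 / 4 : ℝ)) ≤ Real.exp (-(A / B)) := by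
      rw [Real.exp_le_exp, neg_le_neg_iff, div_le_iff₀ hB]; linarith
    have h2 : Real.exp (-(A / A)) = Real.exp (-1) := by rw [div_self hA.ne']
    rw [h2]
    -- `e^{-1/4} ≥ 3/4` (`e^{1/4} ≤ 4/3` since `e ≤ (4/3)^4 = 256/81`) and `e^{-1} ≤ 2/5`
    have h3 : (3 : ℝ) / 4 ≤ Real.exp (-(1 / 4 : ℝ)) := by
      rw [Real.exp_neg]
      have h4 : Real.exp (1 / 4 : ℝ) ≤ 4 / 3 := by
        have hpow : Real.exp (1 / 4 : ℝ) ^ 4 = Real.exp 1 := by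
          rw [← Real.exp_nat_mul]; norm_num
        have he : Real.exp 1 ≤ (4 / 3 : ℝ) ^ 4 := by have := Real.exp_one_lt_d9; norm_num; linarith
        by_contra hcon
        push Not at hcon
        have : (4 / 3 : ℝ) ^ 4 < Real.exp (1 / 4 : ℝ) ^ 4 := pow_lt_pow_left₀ hcon (by norm_num) (by norm_num)
        rw [hpow] at this; linarith
      calc (3 : ℝ) / 4 = (4 / 3)⁻¹ := by norm_num
        _ ≤ (Real.exp (1 / 4 : ℝ))⁻¹ := inv_anti₀ (Real.exp_pos _) h4
    have h5 : Real.exp (-1) ≤ 2 / 5 := by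
      rw [Real.exp_neg]
      calc (Real.exp 1)⁻¹ ≤ (5 / 2 : ℝ)⁻¹ :=
            inv_anti₀ (by norm_num) (by have := Real.exp_one_gt_d9; linarith)
        _ = 2 / 5 := by norm_num
    linarith

/-- **THE SMOOTHING STEP WITH THE MAJORANT** (stub T1 of SKELETON I6c-typed): for `χ² = 1`,
`0 < A`, `4A ≤ B`, `A ≤ M + 1`, `N ≤ B`,
`Σ_{M < n ≤ N} |ν(n)|²/n ≤ 6 · Re (W_{ν⍟ν}(B) − W_{ν⍟ν}(A))`.
[cite: ConreyIwaniec2002, Corollary 6.3 (6.47)–(6.49)] -/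
theorem sum_Ioc_le_conv (hχ : χ ^ 2 = 1) {A B : ℝ} (hA : 0 < A) (hAB : 4 * A ≤ B) {M N : ℕ}
    (hM : A ≤ (M : ℝ) + 1) (hN : (N : ℝ) ≤ B) :
    ∑ n ∈ Finset.Ioc M N, ‖divisorSumChar χ n‖ ^ 2 / (n : ℝ) ≤
      6 * (W (divisorSumChar χ ⍟ divisorSumChar χ) B -
        W (divisorSumChar χ ⍟ divisorSumChar χ) A).re := by
  have hB : 0 < B := by linarith
  set b : ℕ → ℝ := fun n => ((divisorSumChar χ ⍟ divisorSumChar χ) n).re with hb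
  set a : ℕ → ℝ := fun n => b n * (Real.exp (-(n / B)) - Real.exp (-(n / A))) / n with ha
  have hsB := summable_conv_re χ hB
  have hsA := summable_conv_re χ hA
  have hre : (W (divisorSumChar χ ⍟ divisorSumChar χ) B -
      W (divisorSumChar χ ⍟ divisorSumChar χ) A).re = ∑' n, a n := by
    rw [W_conv_eq χ hχ, W_conv_eq χ hχ, ← ofReal_sub, ofReal_re, ← hsB.tsum_sub hsA]
    refine tsum_congr fun n => ?_
    simp only [ha, hb]; ring
  have hb0 : ∀ n, 0 ≤ b n := fun n => conv_re_nonneg χ hχ n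
  have ha0 : ∀ n, 0 ≤ a n := by
    intro n
    have : Real.exp (-(n / A)) ≤ Real.exp (-(n / B)) := by
      rw [Real.exp_le_exp, neg_le_neg_iff]
      exact div_le_div_of_nonneg_left (Nat.cast_nonneg n) hA (by linarith)
    simp only [ha]
    exact div_nonneg (mul_nonneg (hb0 n) (by linarith)) (Nat.cast_nonneg n)
  have hsa : Summable a := by
    have : a = fun n => b n * Real.exp (-(n / B)) / n - b n * Real.exp (-(n / A)) / n := by
      funext n; simp only [ha]; ring
    rw [this]; exact hsB.sub hsA
  rw [hre]
  calc ∑ n ∈ Finset.Ioc M N, ‖divisorSumChar χ n‖ ^ 2 / (n : ℝ)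
      ≤ ∑ n ∈ Finset.Ioc M N, 6 * a n := by
        refine Finset.sum_le_sum fun n hn => ?_
        rw [Finset.mem_Ioc] at hn
        have hn1 : (M : ℝ) + 1 ≤ n := by exact_mod_cast hn.1
        have hAn : A ≤ n := hM.trans hn1
        have hnB : (n : ℝ) ≤ B := le_trans (by exact_mod_cast hn.2) hN
        have hw := one_sixth_le_exp_sub_exp_of_le hA hAB hAn hnB
        have hn0 : (0 : ℝ) < n := hA.trans_le hAn
        have hmaj := norm_sq_divisorSumChar_le_conv_re χ hχ n
        simp only [ha]
        rw [mul_div_assoc', div_le_div_iff_of_pos_right hn0]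
        have h0 : 0 ≤ ‖divisorSumChar χ n‖ ^ 2 := sq_nonneg _
        have hb0n := hb0 n
        calc ‖divisorSumChar χ n‖ ^ 2 ≤ b n := hmaj
          _ = b n * 1 := (mul_one _).symm
          _ ≤ b n * (6 * (Real.exp (-(n / B)) - Real.exp (-(n / A)))) := by
              gcongr; linarith
          _ = 6 * (b n * (Real.exp (-(n / B)) - Real.exp (-(n / A)))) := by ring
    _ = 6 * ∑ n ∈ Finset.Ioc M N, a n := by rw [Finset.mul_sum]
    _ ≤ 6 * ∑' n, a n := by
        gcongr
        exact hsa.sum_le_tsum _ fun n _ => ha0 n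

end Literature.NumberTheory.LFunctions.DivisorSumCharSq

end
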